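import Summits.BirchSwinnertonDyer.BirchSwinnertonDyer.Theorems.ThetaPartnerAtTwoSignedControlAtTwoPlusLocKummerEngine
import Summits.BirchSwinnertonDyer.BirchSwinnertonDyer.Theorems.ThetaPartnerAtTwoSignedControlAtTwoPlusLocalInjOfLift
import HarnessLib

/-!
# LOC⁺@2 — the registered v5 stub `stub_plusLocKummerTwo` of K4 `SignedControlAtTwo` (stmt-BirchSwinnertonDyer-20309, line
# `eulerchar` v5 ed67af6018b68521), VERBATIM — ⟸ the plus Honda system at `2` (HONDA⁺@2): the ONE-theorem glue the lead asked for
# (the hypothesis is VERBATIM the (L)∧(TR)∧(GEN)∧(GEN₀) conjunction, binder order of `SignedEC.plusCyclic_of_honda`)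

Seat `prover-bsd-wall-tp2-p3-w3` (width seat 3/3). Composition of `SignedEC.exists_localLift_kummerOfEmb` (the `⁺` twin of
`SSFlatEC.exists_localLift_flat`), `SignedEC.plusCoinvPair_two_of_honda` (COINV⁺ pair form ⟸ HONDA⁺@2, p584587),
`SignedEC.signedSelmerInfty_le_localKummerOverOfEmb_iSup_signedLocalPoints` (p578798: `Sel⁺_∞` is Kummer-from-`⨆ₙE⁺` at `𝔭`), the
local lift of the topological generator (`ZpExtension.IsCyclotomic.exists_isTopGenerator_resGalOfEmb_adicCompletion`) and the
no-`2`-torsion theorem at a good supersingular `2` (`SSFlatEC.eq_zero_of_mem_localTowerPointsOfEmb_of_two_nsmul`).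

After this file and `…PlusCyclicLayersOfHonda` (p585450) / `…LocalNonDivTwo` (p585289, LEV0@2 PROVED), line `eulerchar` reads:
K4 = PUB(Greenberg ×5) ∘ THEOREM ∘ HONDA⁺@2 — ONE local research stub (the plus Honda system at `2` with generation).

HONEST FRAMING: THEOREMS ONLY (no definition, no named fact, no `sorry`), route-independent; closes no item; BSD is not proved by
any of this.

References: [GreenbergLNM1716] §4 Lemma 4.7 (p. 108); [Kobayashi2003] §8.4, Thm. 6.2, Prop. 8.23; [BDKim2013] Props. 2.2–2.3;
[Sprung2012] Thm. 2.2, Lemma 2.3; [KuriharaOtsuki2006] p. 557.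
-/

set_option autoImplicit false
-- the Theorems namespace of this sub repeats the summit name by design (D-0017 nested layout)
set_option linter.dupNamespace false

noncomputable section

open scoped Classical NumberField

open NumberField IsDedekindDomain WeierstrassCurve Literature.NumberTheory.EllipticCurves
  Literature.NumberTheory.GaloisRepresentations Literature.NumberTheory.EllipticCurves.ZpExtension
  Literature.NumberTheory.EllipticCurves.Kobayashi2003 Literature.NumberTheory.EllipticCurves.Sprung2012
  Summit.BirchSwinnertonDyer.Rank1Residual.Additive

namespace Summit.BirchSwinnertonDyer.BirchSwinnertonDyer.Theorems.SignedEC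

/-- **LOC⁺@2 (Kummer form, the v5 stub's body for one `W`, one cyclotomic `κ`) from a plus Honda system at the place above `2`.**
[cite: GreenbergLNM1716, §4 proof of Lemma 4.7 (p. 108)] [cite: Kobayashi2003, Thm. 6.2, Prop. 8.23, §8.4] [cite: BDKim2013, Props. 2.2–2.3] -/
theorem plusLocKummer_two_of_honda (W : WeierstrassCurve ℚ) [W.IsElliptic] [W.IsGloballyMinimal]
    (hss : Rank1Residual.GoodSS W 2) {κ : ZpExtension ℚ 2} (hκ : κ.IsCyclotomic)
    (hHONDA : ∀ (v : HeightOneSpectrum (𝓞 ℚ)), (2 : 𝓞 ℚ) ∈ v.asIdeal →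
      ∃ d : ℕ → localPoints W (v.adicCompletion ℚ),
        (∀ m, d m ∈ localLayerPointsOfEmb κ (closureEmb (K := ℚ) (v.adicCompletion ℚ)) W m) ∧
        (∀ m, localTraceOfEmb κ (closureEmb (K := ℚ) (v.adicCompletion ℚ)) W (m + 1) (m + 2) (d (m + 2)) = -d m) ∧
        (∀ m : ℕ, 1 ≤ m → ∀ P ∈ localLayerPointsOfEmb κ (closureEmb (K := ℚ) (v.adicCompletion ℚ)) W m,
          ∃ B ∈ AddSubgroup.closure (Set.range fun σ : Field.absoluteGaloisGroup (v.adicCompletion ℚ) ↦ σ • d m),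
            ∃ P' ∈ localLayerPointsOfEmb κ (closureEmb (K := ℚ) (v.adicCompletion ℚ)) W (m - 1),
            ∃ R ∈ localLayerPointsOfEmb κ (closureEmb (K := ℚ) (v.adicCompletion ℚ)) W m, P = B + P' + 2 • R) ∧
        (∀ P ∈ localLayerPointsOfEmb κ (closureEmb (K := ℚ) (v.adicCompletion ℚ)) W 0,
          ∃ a : ℤ, ∃ R ∈ localLayerPointsOfEmb κ (closureEmb (K := ℚ) (v.adicCompletion ℚ)) W 0, P = a • d 0 + 2 • R))
    (t : W.subgroupH1 2 κ.kerSubgroup)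
    (ht : ∀ σ : Field.absoluteGaloisGroup ℚ, W.conjH1 2 κ.kerSubgroup σ t - t ∈ signedSelmerInfty W κ 1)
    (w : HeightOneSpectrum (𝓞 ℚ)) (hw : ((2 : ℕ) : 𝓞 ℚ) ∈ w.asIdeal) :
    ∃ xw : discreteH1 (localSubgroup (⊤ : Subgroup (Field.absoluteGaloisGroup ℚ)) (w.adicCompletion ℚ))
        (localPoints W (w.adicCompletion ℚ)),
      (∃ k : ℕ, 2 ^ k • xw = 0) ∧
      ∀ y : W.subgroupH1 2 (⊤ : Subgroup (Field.absoluteGaloisGroup ℚ)),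
        W.localResOver 2 ⊤ (w.adicCompletion ℚ) y = xw →
        t - W.resOfLe 2 (le_top : κ.kerSubgroup ≤ ⊤) y ∈
          localKummerOverOfEmb W 2 κ.kerSubgroup (closureEmb (K := ℚ) (w.adicCompletion ℚ))
            (⨆ n, signedLocalPoints κ (w.adicCompletion ℚ) W 1 n) := by
  have hw' : (2 : 𝓞 ℚ) ∈ w.asIdeal := by exact_mod_cast hw
  obtain ⟨g, hg⟩ := hκ.exists_isTopGenerator_resGalOfEmb_adicCompletion w hw'
  obtain ⟨d, hd, htr, hgen, hgen0⟩ := hHONDA w hw'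
  have hnt : ∀ P ∈ localTowerPointsOfEmb κ (closureEmb (K := ℚ) (w.adicCompletion ℚ)) W, 2 • P = 0 → P = 0 :=
    fun P hP h2 ↦ SSFlatEC.eq_zero_of_mem_localTowerPointsOfEmb_of_two_nsmul W hss κ hw' _ hP h2
  -- the instance `CharZero ℚ_w` is passed as a term (as a local instance it would let `DivisionRing.toRatAlgebra` compete
  -- with the `adicCompletion` algebra structure)
  refine @exists_localLift_kummerOfEmb ℚ _ _ W _ 2 _ κ (w.adicCompletion ℚ) _
    (charZero_of_injective_algebraMap (algebraMap ℚ (w.adicCompletion ℚ)).injective) _ g hg hnt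
    (⨆ n, signedLocalPoints κ (w.adicCompletion ℚ) W 1 n)
    (iSup_signedLocalPointsOfEmb_le_localTowerPointsOfEmb W κ 1 (closureEmb (K := ℚ) (w.adicCompletion ℚ)))
    ((localLayerPointsOfEmb_zero_le_signedLocalPointsOfEmb κ _ W 1 0).trans
      (le_iSup (fun n ↦ signedLocalPoints κ (w.adicCompletion ℚ) W 1 n) 0))
    (fun σ a ha ↦ ?_) (fun x hx k ↦ ?_) t
    (signedSelmerInfty_le_localKummerOverOfEmb_iSup_signedLocalPoints W κ 1 w hw' (ht _))
  swap
  · obtain ⟨x', hx', m, hm, e⟩ := plusCoinvPair_two_of_honda W hss hκ w hw' hg d hd htr hgen hgen0 x hx k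
    exact ⟨x', hx', m, iSup_signedLocalPointsOfEmb_le_localTowerPointsOfEmb W κ 1
      (closureEmb (K := ℚ) (w.adicCompletion ℚ)) hm, e⟩
  -- `Γ_{ℚ_w}`-stability of `⨆ₙ E⁺_n`
  refine AddSubgroup.iSup_induction (fun n ↦ signedLocalPoints κ (w.adicCompletion ℚ) W 1 n)
    (C := fun a ↦ σ • a ∈ ⨆ n, signedLocalPoints κ (w.adicCompletion ℚ) W 1 n) ha ?_ ?_ ?_
  · intro n a ha
    refine le_iSup (fun n ↦ signedLocalPoints κ (w.adicCompletion ℚ) W 1 n) n ?_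
    have ha' : a ∈ signedLocalPointsOfEmb κ (closureEmb (K := ℚ) (w.adicCompletion ℚ)) W 1 n := ha
    show σ • a ∈ signedLocalPointsOfEmb κ (closureEmb (K := ℚ) (w.adicCompletion ℚ)) W 1 n
    rw [signedLocalPointsOfEmb_eq_towerSigned] at ha' ⊢
    exact smul_mem_towerSignedLocalPointsOfEmb κ.layerSubgroup _ W 1 n σ ha'
  · rw [smul_zero]; exact AddSubgroup.zero_mem _
  · intro a b ha hb; rw [smul_add]; exact AddSubgroup.add_mem _ ha hb

/-- **The registered v5 stub `stub_plusLocKummerTwo` (LOC⁺@2) VERBATIM ⟸ (HONDA⁺@2) over the sub-row** — the hypothesis is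
VERBATIM the conjunction of `stub_plusCyclicLayersTwo_of_honda` / `stub_plusLocalInjTwo_of_honda` (the lead's v6
`stub_plusHondaSystemTwo`). [cite: GreenbergLNM1716, §4 Lemma 4.7] [cite: Kobayashi2003, §8.4, Thm. 6.2] [cite: KuriharaOtsuki2006, p. 557] -/
theorem stub_plusLocKummerTwo_of_honda
    (hHONDA : ∀ (W : WeierstrassCurve ℚ) [W.IsElliptic] [W.IsGloballyMinimal],
      ¬ W.HasCM → W.analyticRank = 0 → Rank1Residual.GoodSS W 2 → W.frobeniusTrace 2 = 0 →
      ∀ (κ : ZpExtension ℚ 2), κ.IsCyclotomic →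
      ∀ (v : HeightOneSpectrum (𝓞 ℚ)), (2 : 𝓞 ℚ) ∈ v.asIdeal →
      ∃ d : ℕ → localPoints W (v.adicCompletion ℚ),
        (∀ m, d m ∈ localLayerPointsOfEmb κ (closureEmb (K := ℚ) (v.adicCompletion ℚ)) W m) ∧
        (∀ m, localTraceOfEmb κ (closureEmb (K := ℚ) (v.adicCompletion ℚ)) W (m + 1) (m + 2) (d (m + 2)) = -d m) ∧
        (∀ m : ℕ, 1 ≤ m → ∀ P ∈ localLayerPointsOfEmb κ (closureEmb (K := ℚ) (v.adicCompletion ℚ)) W m,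
          ∃ B ∈ AddSubgroup.closure (Set.range fun σ : Field.absoluteGaloisGroup (v.adicCompletion ℚ) ↦ σ • d m),
            ∃ P' ∈ localLayerPointsOfEmb κ (closureEmb (K := ℚ) (v.adicCompletion ℚ)) W (m - 1),
            ∃ R ∈ localLayerPointsOfEmb κ (closureEmb (K := ℚ) (v.adicCompletion ℚ)) W m, P = B + P' + 2 • R) ∧
        (∀ P ∈ localLayerPointsOfEmb κ (closureEmb (K := ℚ) (v.adicCompletion ℚ)) W 0,
          ∃ a : ℤ, ∃ R ∈ localLayerPointsOfEmb κ (closureEmb (K := ℚ) (v.adicCompletion ℚ)) W 0, P = a • d 0 + 2 • R)) :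
    ∀ (W : WeierstrassCurve ℚ) [W.IsElliptic] [W.IsGloballyMinimal],
      ¬ W.HasCM → W.analyticRank = 0 → Rank1Residual.GoodSS W 2 → W.frobeniusTrace 2 = 0 →
      ∀ (κ : ZpExtension ℚ 2), κ.IsCyclotomic →
      ∀ t : W.subgroupH1 2 κ.kerSubgroup,
        (∀ σ : Field.absoluteGaloisGroup ℚ, W.conjH1 2 κ.kerSubgroup σ t - t ∈ signedSelmerInfty W κ 1) →
        ∀ w : HeightOneSpectrum (𝓞 ℚ), ((2 : ℕ) : 𝓞 ℚ) ∈ w.asIdeal →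
        ∃ xw : discreteH1 (localSubgroup (⊤ : Subgroup (Field.absoluteGaloisGroup ℚ)) (w.adicCompletion ℚ))
            (localPoints W (w.adicCompletion ℚ)),
          (∃ k : ℕ, 2 ^ k • xw = 0) ∧
          ∀ y : W.subgroupH1 2 (⊤ : Subgroup (Field.absoluteGaloisGroup ℚ)),
            W.localResOver 2 ⊤ (w.adicCompletion ℚ) y = xw →
            t - W.resOfLe 2 (le_top : κ.kerSubgroup ≤ ⊤) y ∈
              localKummerOverOfEmb W 2 κ.kerSubgroup (closureEmb (K := ℚ) (w.adicCompletion ℚ))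
                (⨆ n, signedLocalPoints κ (w.adicCompletion ℚ) W 1 n) :=
  fun W _ _ hcm hr hss ha κ hκ t ht w hw ↦
    plusLocKummer_two_of_honda W hss hκ (fun v hv ↦ hHONDA W hcm hr hss ha κ hκ v hv) t ht w hw

end Summit.BirchSwinnertonDyer.BirchSwinnertonDyer.Theorems.SignedEC

end
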